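import Mathlib
import Summits.ValiantsHypothesis.ValiantsHypothesis.Theorems.SoloInformedQuadSpanReduction
import Summits.ValiantsHypothesis.ValiantsHypothesis.Theorems.SoloInformedProductTrick
import Summits.ValiantsHypothesis.ValiantsHypothesis.Theorems.SoloInformedRSDesign
import HarnessLib

/-!
# The quadratic-span reduction with growing order and height (solo seat
`solo-ValiantsHypothesis-informed`, s25)

The reduction `soloInformed_vp_ne_vnp_of_quadSpanBound_cor58` (file `SoloInformedQuadSpanReduction`)
asks for ONE order `K` and ONE height `h` and a bound `Q_{K,h}(s)` beating the design size.  Nothing in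
its proof uses that `K, h` are constant in `n`: the elusiveness step `soloInformed_isElusive_designMap`
is applied degree by degree.  This file records the consequence, which changes the arena of the
soloist's Conjecture Q* (note `paper/quadspan.md`, Remark 2.9 (2′) and §7.19):

* `soloInformed_vp_ne_vnp_of_quadSpanBound_growing` — orders `K n`, heights `h n`, bounds
  `B n : SoloQuadSpanBound (K n) (h n)` and designs `S n : SoloDesign (K n) (h n) (m n) n` may all
  depend on `n`; if `(B n).Q (s n) < m n = C(n + r n − 1, r n)` eventually (plus Raz's side
  conditions and poly-definability, kept as hypotheses exactly as before) then `VP ℂ ≠ VNP ℂ`.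
  With Reed–Solomon designs (`soloInformed_nonempty_design`: `(K − 1)(k − 1) < q`, `q² ≤ n`,
  `m ≤ q^k`) the admissible order is `K(n) ≍ √n / r(n)`, i.e. `K = s^{o(1)}` but super-polylogarithmic
  in `s`, and the height `h(n)` is unrestricted.
* `soloInformed_quadSpan_card_le_three_mul` — the first point of the ORDER PROFILE from the landed
  product trick: a `(2s, 1)`-free exponent set realised in the quadratic span of `s ≥ 1` algebraic
  functions has at most `3s` elements (`C(|E|, s) ≤ C(3s, 2s)` forces `|E| ≤ 3s`).  So at order
  `≍ s` the count is LINEAR, at bounded order the monomial baseline is `s^{1+1/⌊K/2⌋}`, and the summit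
  needs `s^{3/2−δ}` at order `s^{o(1)}`.

Nothing here constructs a `SoloQuadSpanBound` beating `s^{3/2}`; nothing is credited toward the summit.

References: R. Raz, Theory of Computing 6 (2010) 135–177, Cor. 1.14 = Cor. 5.8 (tree:
`Raz2010_cor_5_8_holds`).
-/

noncomputable section

open MvPolynomial Finset

namespace Summit.ValiantsHypothesis.ValiantsHypothesis.Theorems

open Literature.Computability.AlgebraicComplexity

/-- **The reduction with growing order and height.**  For every `n` let `K n ≥ 2`, `h n ≥ 1`, a
hypothesis-carrying bound `B n : SoloQuadSpanBound (K n) (h n)` and a `(K n, h n)`-design `S n` of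
`C(n + r n − 1, r n)` subsets of `Fin n` be given.  If Raz's side conditions hold, the bound beats the
design size eventually, and the design monomial map is poly-definable, then `VP ℂ ≠ VNP ℂ`. -/
theorem soloInformed_vp_ne_vnp_of_quadSpanBound_growing (K h : ℕ → ℕ)
    (hK : ∀ n, 2 ≤ K n) (hh : ∀ n, 1 ≤ h n)
    (B : ∀ n, SoloQuadSpanBound (K n) (h n)) {r s : ℕ → ℕ}
    (S : ∀ n, SoloDesign (K n) (h n) (Nat.choose (n + r n - 1) (r n)) n)
    (hpar : ∃ n₀ : ℕ, ∀ n ≥ n₀, 3 ≤ r n ∧ r n ≤ n ∧ n ≤ s n)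
    (hgrow : ∀ c : ℕ, ∃ n₀ : ℕ, ∀ n ≥ n₀,
      n ^ c * Nat.choose (n + 2 * r n / 3 - 1) (2 * r n / 3) ≤ s n)
    (hQm : ∃ n₀ : ℕ, ∀ n ≥ n₀, (B n).Q (s n) < Nat.choose (n + r n - 1) (r n))
    (hdef : IsPolyDefinableMap (m := fun n => Nat.choose (n + r n - 1) (r n))
      (σ := fun n => Fin n) fun n => soloDesignMap (S n).S) :
    VP ℂ ≠ VNP ℂ := by
  refine perNotPComputableComplex_iff_holds.mp ?_
  have hel : ∃ n₀ : ℕ, ∀ n ≥ n₀, ∃ (G : Type) (_ : Field G) (_ : Algebra ℂ G),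
      IsElusive (fun i => MvPolynomial.map (algebraMap ℂ G) (soloDesignMap (S n).S i))
        (s n) 2 := by
    obtain ⟨n₀, h0⟩ := hQm
    refine ⟨n₀, fun n hn => ⟨ℂ, inferInstance, inferInstance, ?_⟩⟩
    have hid : (fun i => MvPolynomial.map (algebraMap ℂ ℂ) (soloDesignMap (S n).S i))
        = soloDesignMap (S n).S := by
      funext i
      rw [Algebra.algebraMap_self, MvPolynomial.map_id]
    rw [hid]
    exact soloInformed_isElusive_designMap (hK n) (hh n) (S n) (B n) (h0 n hn)
  exact Raz2010_cor_5_8_holds ℂ ringChar_complex_ne_two r s (fun n => soloDesignMap (S n).S)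
    hpar hgrow hdef hel

/-- The summit statement itself from the growing-order hypotheses (`ValiantsHypothesis` is
definitionally `VP ℂ ≠ VNP ℂ`). -/
theorem soloInformed_validity_of_quadSpanBound_growing (K h : ℕ → ℕ)
    (hK : ∀ n, 2 ≤ K n) (hh : ∀ n, 1 ≤ h n)
    (B : ∀ n, SoloQuadSpanBound (K n) (h n)) {r s : ℕ → ℕ}
    (S : ∀ n, SoloDesign (K n) (h n) (Nat.choose (n + r n - 1) (r n)) n)
    (hpar : ∃ n₀ : ℕ, ∀ n ≥ n₀, 3 ≤ r n ∧ r n ≤ n ∧ n ≤ s n)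
    (hgrow : ∀ c : ℕ, ∃ n₀ : ℕ, ∀ n ≥ n₀,
      n ^ c * Nat.choose (n + 2 * r n / 3 - 1) (2 * r n / 3) ≤ s n)
    (hQm : ∃ n₀ : ℕ, ∀ n ≥ n₀, (B n).Q (s n) < Nat.choose (n + r n - 1) (r n))
    (hdef : IsPolyDefinableMap (m := fun n => Nat.choose (n + r n - 1) (r n))
      (σ := fun n => Fin n) fun n => soloDesignMap (S n).S) :
    _root_.ValiantsHypothesis :=
  soloInformed_vp_ne_vnp_of_quadSpanBound_growing K h hK hh B S hpar hgrow hQm hdef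

/-- **Reed–Solomon designs of growing order.**  For every `n` with a prime `q n`,
`(K n − 1)(k n − 1) < q n`, `C(n + r n − 1, r n) ≤ (q n)^(k n)` and `(q n)² ≤ n`, a
`(K n, h n)`-design of the size used above exists, for EVERY height function `h`. -/
theorem soloInformed_nonempty_design_growing (K h k q r : ℕ → ℕ)
    (hq : ∀ n, (q n).Prime) (hKq : ∀ n, (K n - 1) * (k n - 1) < q n)
    (hm : ∀ n, Nat.choose (n + r n - 1) (r n) ≤ q n ^ k n) (hn : ∀ n, q n * q n ≤ n) :
    ∀ n, Nonempty (SoloDesign (K n) (h n) (Nat.choose (n + r n - 1) (r n)) n) :=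
  fun n => soloInformed_nonempty_design (K n) (h n) (k n) (q n) _ n (hq n) (hKq n) (hm n) (hn n)

/-- **Order profile, first point: linear at order `2s`.**  If `s ≥ 1` and `E` is `(2s, 1)`-free
(no `± 1` relation with at most `2s` terms) and every `z^e`, `e ∈ E`, lies in the quadratic span
of `s` algebraic functions, then `|E| ≤ 3s`.  (Product trick `C(|E|, s) ≤ C(s + 2s, 2s) = C(3s, s)`.) -/
theorem soloInformed_quadSpan_card_le_three_mul (s : ℕ) (hs : 1 ≤ s) (b : Fin s → SoloΩ)
    (E : Finset ℕ)
    (hfree : ∀ c : ℕ → ℤ, (E.filter fun e => c e ≠ 0).card ≤ 2 * s → (∀ e, |c e| ≤ 1) →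
      (∑ e ∈ E, c e * (e : ℤ)) = 0 → ∀ e ∈ E, c e = 0)
    (hE : ∀ e ∈ E, ∃ Γ : MvPolynomial (Fin s) ℂ, Γ.totalDegree ≤ 2 ∧ aeval b Γ = soloZ ^ e) :
    E.card ≤ 3 * s := by
  have h1 : (E.card).choose s ≤ (s + 2 * s).choose (2 * s) :=
    soloInformed_productTrick_soloΩ s 1 le_rfl s b E hfree hE
  have h2 : (s + 2 * s).choose (2 * s) = (3 * s).choose s := by
    have : s + 2 * s = 3 * s := by ring
    rw [this, show 2 * s = 3 * s - s by omega, Nat.choose_symm (by omega)]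
  rw [h2] at h1
  by_contra hlt
  have hlt' : 3 * s + 1 ≤ E.card := by omega
  have h3 : (3 * s + 1).choose s ≤ (E.card).choose s := Nat.choose_le_choose s hlt'
  have h4 : (3 * s).choose s < (3 * s + 1).choose s := by
    have hrec : (3 * s + 1).choose s = (3 * s).choose (s - 1) + (3 * s).choose s := by
      obtain ⟨t, rfl⟩ : ∃ t, s = t + 1 := ⟨s - 1, by omega⟩
      simp [Nat.choose_succ_succ]
    have hpos : 0 < (3 * s).choose (s - 1) := Nat.choose_pos (by omega)
    omega
  omega

end Summit.ValiantsHypothesis.ValiantsHypothesis.Theorems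

end
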